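import Literature.AlgebraicGeometry.Frobenioids.PadicFrobenioidSelfEquivalenceDiv
import Literature.AlgebraicGeometry.Frobenioids.ModelFrobenioidSelfEquivalenceRigidityEndUnits
import HarnessLib

/-!
# [IUTchI] Cor. 5.3 (ii)/(iv) kernel triviality at a `p`-adic Frobenioid: a self-equivalence over the identity of the
# base is `≅ 𝟭` as soon as it fixes the units of base-identity linear endomorphisms ([FrdII] Thm. 2.4 unit transport)

Mochizuki, *The geometry of Frobenioids I*, Kyushu J. Math. **62** (2008), Thm. 5.2 (iv) pp. 101–103, Prop. 5.6 p. 105,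
Cor. 4.11 (iv) p. 92 [cite: MochizukiFrdI2008, Thm. 5.2(iv) p.102]; *The geometry of Frobenioids II*, Ex. 1.1 (ii) p. 8
[cite: MochizukiFrdII2008, Ex 1.1 (ii) p.8]; consumer locus [IUTchI] proof of Cor. 5.3 (iv) p. 144 l. 42 – p. 145 l. 9
[cite: Mochizuki2012, Cor. 5.3(iv) p.145].

PROOF-ONLY assembly (abc-iut, row «C53ii/S2c HMON-AT-REAL-CV», this file abc-iut-L1-t7): for the `p`-adic Frobenioid
`C = d.frobenioid` of a [FrdII] Ex. 1.1 (ii) datum over a slim base of FSM-type with (INT) `ord(𝒪^▷) ⊗ 1 ⊆ Φ`, (PF)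
`Φ ⊆ (ord(𝒪^▷) ⊗ 1)^pf` and `Φ` totally ordered by divisibility (rank one), a self-equivalence `Ψ : C ≌ C` with
`η₀ : Ψ ⋙ Base ≅ Base` that preserves Frobenius degrees ([FrdI] Thm. 3.4 (iii), in the tree
`PadicFrd.Datum.degFr_map_of_equivalence` over tempered coset bases) and fixes through `η₀` the unit of every base-identity
linear endomorphism (`hO` — the ONE displayed input: «the unit transport of [FrdII] Thm. 2.4 induced by `Ψ` is the
identity», i.e. Kummer-pair rigidity [AbsTopIII] Prop. 3.2 (iv)) is isomorphic to `𝟭_C`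
(`nonempty_iso_id_of_over_base_of_endUnits`): `hdiv` is the theorem `div_map_eq_pull_of_over_base`
(`PadicFrobenioidSelfEquivalenceDiv.lean`), `B = K^×` is group-like, and the model-Frobenioid rigidity
`ModelFrobenioid.nonempty_iso_id_of_over_baseIso_of_endUnits` applies.  So the kernel-triviality input `hker` of
abc-iut-L5-t4's `Cor53.cosetCat_descend_injective_of_kernel_trivial` reduces, at such data, to the single law `hO`.
No statement of either paper is restated as a fact; nothing here bears on [IUTchIII] Cor. 3.12.
-/

namespace Literature.AlgebraicGeometry.Frobenioids

open CategoryTheory Opposite Function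

universe v u

namespace PadicFrd

namespace Datum

variable {D : Type u} [Category.{v} D] {p : ℕ} [Fact p.Prime] (d : Datum D p)

/-- **Kernel triviality at a `p`-adic Frobenioid, modulo the unit-transport law `hO`.**  Over a slim base of FSM-type,
with (INT), (PF) and `Φ` of rank one, a self-equivalence `Ψ` of `d.frobenioid` lying over the identity of the base
(`η₀`), preserving Frobenius degrees and fixing through `η₀` the unit of every base-identity linear endomorphism, is
`≅ 𝟭`. [cite: MochizukiFrdI2008, Thm. 5.2(iv) p.102] [cite: Mochizuki2012, Cor. 5.3(iv) p.145] -/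
theorem nonempty_iso_id_of_over_base_of_endUnits (hD : IsOfFSMType D) (hsl : IsSlim D)
    (hint : ∀ (A : D) (a : OrdInt (d.fld A)), ∃ c : d.Φ.obj (op A), d.ιHom A c = Realification.of _ a)
    (hpf : ∀ (A : D) (c : d.Φ.obj (op A)), ∃ n : ℕ, 0 < n ∧ ∃ a : OrdInt (d.fld A),
      d.ιHom A (c ^ n) = Realification.of _ a)
    (hΦ : ∀ (A : Dᵒᵖ) (z z' : d.Φ.obj A), (∃ w, z = z' * w) ∨ (∃ w, z' = z * w))
    (Ψ : d.frobenioid ≌ d.frobenioid)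
    (η₀ : Ψ.functor ⋙ ModelFrobenioid.baseFunctor d.Φ d.B d.divB ≅ ModelFrobenioid.baseFunctor d.Φ d.B d.divB)
    (hdeg : ∀ ⦃X Y : d.frobenioid⦄ (φ : X ⟶ Y),
      ModelFrobenioid.degFr (Ψ.functor.map φ) = ModelFrobenioid.degFr φ)
    (hO : ∀ (X : d.frobenioid) (τ : X ⟶ X), ModelFrobenioid.degFr τ = 1 → ModelFrobenioid.baseMap τ = 𝟙 X.base →
      ModelFrobenioid.unit (Ψ.functor.map τ) =
        Frobenioids.pull d.B (A := X.base) (B := (Ψ.functor.obj X).base) (η₀.hom.app X) (ModelFrobenioid.unit τ)) :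
    Nonempty (Ψ.functor ≅ 𝟭 d.frobenioid) :=
  ModelFrobenioid.nonempty_iso_id_of_over_baseIso_of_endUnits (Ψ := Ψ.functor) (fun A b => d.isUnit_B A b) hΦ η₀ hdeg
    (fun _ _ φ => d.div_map_eq_pull_of_over_base hD hsl hint hpf Ψ η₀ φ) hO

/-- The same with the base hypothesis in abc-iut-L5-t4's `LiesUnder … (Equivalence.refl)` spelling
(`Ψ.functor ⋙ Base ≅ Base ⋙ 𝟭`): the `hker` input of `Cor53.cosetCat_descend_injective_of_kernel_trivial` at such a
datum reduces to the unit-transport law `hO` (quantified over the identification `η₀` obtained from the given one).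
[cite: MochizukiFrdI2008, Thm. 5.2(iv) p.102] [cite: Mochizuki2012, Cor. 5.3(iv) p.145] -/
theorem nonempty_iso_id_of_liesUnder_refl_of_endUnits (hD : IsOfFSMType D) (hsl : IsSlim D)
    (hint : ∀ (A : D) (a : OrdInt (d.fld A)), ∃ c : d.Φ.obj (op A), d.ιHom A c = Realification.of _ a)
    (hpf : ∀ (A : D) (c : d.Φ.obj (op A)), ∃ n : ℕ, 0 < n ∧ ∃ a : OrdInt (d.fld A),
      d.ιHom A (c ^ n) = Realification.of _ a)
    (hΦ : ∀ (A : Dᵒᵖ) (z z' : d.Φ.obj A), (∃ w, z = z' * w) ∨ (∃ w, z' = z * w))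
    (Ψ : d.frobenioid ≌ d.frobenioid)
    (h : Ψ.functor ⋙ ModelFrobenioid.baseFunctor d.Φ d.B d.divB ≅
      ModelFrobenioid.baseFunctor d.Φ d.B d.divB ⋙ (CategoryTheory.Equivalence.refl (C := D)).functor)
    (hdeg : ∀ ⦃X Y : d.frobenioid⦄ (φ : X ⟶ Y),
      ModelFrobenioid.degFr (Ψ.functor.map φ) = ModelFrobenioid.degFr φ)
    (hO : ∀ (η₀ : Ψ.functor ⋙ ModelFrobenioid.baseFunctor d.Φ d.B d.divB ≅ ModelFrobenioid.baseFunctor d.Φ d.B d.divB)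
      (X : d.frobenioid) (τ : X ⟶ X), ModelFrobenioid.degFr τ = 1 → ModelFrobenioid.baseMap τ = 𝟙 X.base →
      ModelFrobenioid.unit (Ψ.functor.map τ) =
        Frobenioids.pull d.B (A := X.base) (B := (Ψ.functor.obj X).base) (η₀.hom.app X) (ModelFrobenioid.unit τ)) :
    Nonempty (Ψ.functor ≅ 𝟭 d.frobenioid) :=
  d.nonempty_iso_id_of_over_base_of_endUnits hD hsl hint hpf hΦ Ψ
    (h ≪≫ (ModelFrobenioid.baseFunctor d.Φ d.B d.divB).rightUnitor) hdeg
    (hO (h ≪≫ (ModelFrobenioid.baseFunctor d.Φ d.B d.divB).rightUnitor))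

end Datum

end PadicFrd

end Literature.AlgebraicGeometry.Frobenioids
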